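import Summits.QuantumFields.YangMills.Theorems.BalabanUVNodesN15TwoSpacingGluingCurvedKnitSmallFieldAdjointDefect
import Summits.QuantumFields.YangMills.Theorems.BalabanUVNodesN15TwoSpacingGluingCurvedKnitSmallFieldAdjointFine
import Summits.QuantumFields.YangMills.Theorems.BalabanUVNodesN15TwoSpacingGluingCurvedKnitSmallFieldCovariantGradientBackward
import Summits.QuantumFields.YangMills.Theorems.BalabanUVNodesN15CurvedGluingAdjointCovariantEntryGlued
import HarnessLib

/-!
# THE η-DEFECT OF THE PRINT's ENTRY 2 `𝒢∘∇^{U*}_ν` — THE LIVE GLUED PROPAGATOR RIGHT-COMPOSED WITH THE COVARIANT BACKWARD DERIVATIVE `D^η_{R⁻_ν}` ALONG `τ_ν⁻¹` — IN THE GLOBAL SMALL-FIELD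
# GAUGE, EVERY ROW PRODUCED: FILE 159's right-composed transport `(𝒢∘∇̂⁻)∘M_{R∘e} − 𝒢∘M_{∇R} + 𝒢∘M_B` fed with n15-c∕178 (two-grid), 176f (fine one-grid), FILE 133 (entry-0 rows),
# FILE 130 (entry-0 defect) and dag-n15-w2's letters of `R⁻ = 1 − η·a⁻` (dag-n15-c g20, n15-c∕179; N15 = NE2, s1 road (c) «print-faithful non-abelian G(U)»)

Cell `pub-ymgap`, seat `pub-ymgap-dag-n15-c` (R134 (a); HUMAN RULING D-0062), generation 20.  `bears_on: R4∕N15 · K3⁸ SpineGivenEndpointR13SepCoPHV (stmt-QuantumFields-27366)`.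
Filed `--kind proof --supports stmt-QuantumFields-27366 --as helper` — COUNT-NEUTRAL.  Theorems only; 0 `def`, 0 `sorry`.  Imports BY NAME n15-c∕178 `…CurvedKnitSmallFieldAdjointDefect`
(★★★ `sf_idef_bgrad_cvGlued`), n15-c∕176f `…CurvedKnitSmallFieldAdjointFine` (★★★ `sf_bgrad_cvGlued'_spec`), FILE 146 `…SmallFieldCovariantGradientBackward` (`covD_transport_inr`,
`transport_inr_eq`, `rowSum_one_sub_smul_le`, `rowFit_one_sub_smul_le`; through it FILE 144 `exp_eq_expTrField`, FILE 133 `sf_cvGlued_pair_spec`, FILE 130 `sf_idef_cvGlued`, dag-n15-w2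
`twoSidedLetters_curvCoef_one_of_meanGauge`), FILE 159 `…AdjointCovariantEntryGlued` (★ `comp_covShape_bgrad_eq`, ★★ `hasMaj_idef_gluedCovShape`).  Nothing in the tree is modified.

WHAT.  §1 `fgradMat_one_sub_smul_apply`, `rowSum_neg_mul_le`, `rowFit_neg_mul_le` (rows∕fit of `∇(1 − η·a) = −η·∇a`).  §2 ★★★ `sf_idef_bgradCov_cvGlued`: for odd `L ≥ 7`, `a > 0`, `ι`:
`∃ δ w₀ R₀ D`, for every cover torus (`k ≥ 1`, `L^m ≥ w₀`), refinement `r`, direction `ν`, trace-form `e`, EVERY skew-Hermitian fine potential `A′` in the C² window (FILE 130∕133's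
hypotheses VERBATIM), the η-defect along King's pairing of `cvGlued′ … e^{η′A′} … ∘ D^{η′}_{R′⁻_ν}` against `cvGlued … e^{ηĀ′} … ∘ D^η_{R⁻_ν}` — n15-b's `covD η (gaugePair τ S (inr ν)) (τ ν)⁻¹`
RIGHT-composed (the print's `G∇*_U`: for unitary transports `(∇_U)* = −∇_U^{bwd}`) — is `≤ D·((L^k)^{−1∕16} + (L^k)^{−1∕(8(d+1))} + scale·(1+|J⊕J|)·η)·e^{−δ|y−y′|}` blockwise.
Proof: `D^η_{R⁻} = −(M_{R⁻}∇̂⁻ + M_{a⁻})` (FILE 146), FILE 159 ★ moves the transport to the right of `𝒢∘∇̂⁻`, FILE 159 ★★ bounds the defect from: the fine one-grid rows of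
`𝒢′∘∇̂′⁻` (176f) and `𝒢′` (FILE 133), the defects of `𝒢∘∇̂⁻` (178) and `𝒢` (FILE 130), and the rows∕fits of `R⁻∘τ`, `∇R⁻`, `a⁻` (dag-n15-w2's letters 2, 4, 6, 9, 10, 14, 15).

HONEST FRAMING ∕ LIMITS.  Assembly of LANDED theorems + matrix row-sum bookkeeping; MODEL operator (covariant Laplacian (3.50) ⊗ colour + FLAT nonlocal part (1.69)) ∕ MODEL class ∕
King's pairing ∕ dag-n15-a's carriers; constants crude; the SHAPE of [B9] (3.42) entry `G∇*_U` and of Thm 3.14's difference template, NOT the printed theorems; nothing of [B5]∕[B6]∕[B9]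
asserted.  NE2 for non-abelian `G(U)` NOT proved (C-N15-1); N15 of record untouched (№253) — road (c)'s bookkeeping, NO count; K3⁸ skeleton untouched; one finite 𝕋⁴ at fixed ε — NOT
infinite volume, NOT OS, NOT a mass gap, NOT Clay.  Restate-immune (no Theses import).
-/

noncomputable section

open scoped BigOperators Matrix Matrix.Norms.Frobenius

namespace Summit.QuantumFields.YangMills.BalabanUVNodes.N15.Gluing

open Literature.MathematicalPhysics.QuantumFieldTheory.Balaban1983to89
open Literature.MathematicalPhysics.QuantumFieldTheory.Balaban1983to89.B11SectG (BlockNorm HasMaj)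
open Literature.MathematicalPhysics.QuantumFieldTheory.Balaban1983to89.T4EtaRateDefect (idef idef_add idef_sub)
open Literature.MathematicalPhysics.QuantumFieldTheory.Balaban1983to89.T4EtaRateCoeffDefect (pull)
open Literature.MathematicalPhysics.QuantumFieldTheory.Balaban1983to89.B6Prop26Gluing (mulOp)
open Literature.MathematicalPhysics.QuantumFieldTheory.Balaban1983to89.B6UnitTorusCarrier (unitTorusGeo unitTorusGeo_dist_nonneg)
open Literature.MathematicalPhysics.QuantumFieldTheory.Balaban1983to89.B5Prop11Plancherel (Tor)
open Literature.MathematicalPhysics.QuantumFieldTheory.King1986.Torus (blockOf)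
open Literature.Barriers.QuantumFields (traceForm)
open Literature.MathematicalPhysics.QuantumFieldTheory.Balaban1983to89.Beta.AveragingCorrectionJets (adCLM)
open Summit.QuantumFields.YangMills.BalabanUVNodes.N15.BackgroundLayer (covLapM tCoefA tCoefC tCoefA_inr gavgM fgrad bgrad fgradMat)
open Summit.QuantumFields.YangMills.BalabanUVNodes.N15.VectorPiece (bshiftEquiv kingPrV kingPrV_bshiftEquiv_pow fibre_conn_kingPrV bshiftEquiv_comm)
open Summit.QuantumFields.YangMills.BalabanUVNodes.N15.MatrixSpecies (mmulOp coordMat basisConst basisConst_nonneg liftBlk liftMap liftEquiv covD)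
open Summit.QuantumFields.YangMills.BalabanUVNodes.N15.CurvedSpecies (gaugePair gaugePair_inr expTrField expTrField_apply curvCoefA_one twoSidedLetters_curvCoef_one_of_meanGauge
  coordMat_adCLM_transpose_eq_neg_of_conjTranspose)
open Summit.QuantumFields.YangMills.BalabanUVNodes.N15.TwoGrid (idef_neg_neg)

variable {d : ℕ}

/-! ## §1 Rows and fit of `∇R⁻ = −η·∇a⁻` -/

section Rows

variable {X ι : Type} [Fintype ι] [DecidableEq ι]

omit [Fintype ι] in
/-- `∇(1 − η·a)(x)_{ij} = −η·(∇a)(x)_{ij}`. [folklore] -/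
theorem fgradMat_one_sub_smul_apply (n η : ℝ) (e : X ≃ X) (b : X → Matrix ι ι ℝ) (x : X) (i j : ι) :
    fgradMat n e (fun x => 1 - η • b x) x i j = -(η * fgradMat n e b x i j) := by
  simp only [fgradMat, Matrix.smul_apply, Matrix.sub_apply, smul_eq_mul]
  ring

omit [DecidableEq ι] in
/-- rows of `−η·f`: `Σ_j|−(η f_j)| ≤ η·α` from `Σ_j|f_j| ≤ α`, `η ≥ 0`. [folklore] -/
theorem rowSum_neg_mul_le {f : ι → ℝ} {α η : ℝ} (hη : 0 ≤ η) (hf : ∑ j, |f j| ≤ α) : ∑ j, |-(η * f j)| ≤ η * α := by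
  calc ∑ j, |-(η * f j)| = η * ∑ j, |f j| := by
        rw [Finset.mul_sum]; exact Finset.sum_congr rfl fun j _ => by rw [abs_neg, abs_mul, abs_of_nonneg hη]
    _ ≤ η * α := mul_le_mul_of_nonneg_left hf hη

omit [DecidableEq ι] in
/-- fit of `−η′·f′` against `−η·f`: `≤ η′·o + |η′ − η|·α` from `Σ_j|f′_j − f_j| ≤ o`, `Σ_j|f_j| ≤ α`, `η′ ≥ 0`. [folklore] -/
theorem rowFit_neg_mul_le {f f' : ι → ℝ} {α o η η' : ℝ} (hη' : 0 ≤ η') (hf : ∑ j, |f j| ≤ α) (hfit : ∑ j, |f' j - f j| ≤ o) :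
    ∑ j, |-(η' * f' j) - -(η * f j)| ≤ η' * o + |η' - η| * α := by
  calc ∑ j, |-(η' * f' j) - -(η * f j)| ≤ ∑ j, (η' * |f' j - f j| + |η' - η| * |f j|) := Finset.sum_le_sum fun j _ => by
          rw [show -(η' * f' j) - -(η * f j) = -(η' * (f' j - f j) + (η' - η) * f j) by ring, abs_neg]
          exact (abs_add_le _ _).trans (by rw [abs_mul, abs_mul, abs_of_nonneg hη'])
    _ = η' * ∑ j, |f' j - f j| + |η' - η| * ∑ j, |f j| := by rw [Finset.sum_add_distrib, Finset.mul_sum, Finset.mul_sum]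
    _ ≤ η' * o + |η' - η| * α := add_le_add (mul_le_mul_of_nonneg_left hfit hη') (mul_le_mul_of_nonneg_left hf (abs_nonneg _))

end Rows

/-! ## §2 The η-defect of `𝒢∘D^η_{R⁻_ν}` for the live glued family, every row produced -/

section Defect

variable {L : ℕ} [NeZero L]

set_option maxHeartbeats 1600000 in
/-- ★★★ **THE η-DEFECT OF THE ADJOINT COVARIANT ENTRY `𝒢∘D^η_{R⁻_ν}` (THE PRINT's `G∇*_U`, RIGHT-COMPOSED) OF THE LIVE-BACKGROUND GLUED PROPAGATORS AT THE COVER IN THE GLOBAL SMALL-FIELD GAUGE,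
EVERY ROW PRODUCED.**  MODEL operator ∕ class ∕ pairing ∕ carriers; NOT [B9] Thm 3.1∕3.14 as printed.
[cite: Balaban1985BackgroundPropagators, Thm 3.1 p.397 ((3.42), entry `G∇*_U`: shape), (3.50)–(3.53) p.400, (3.64)–(3.65) pp.402–403, Thm 3.14 pp.426–427 (difference template), (3.35)–(3.36) p.396; King1986, p.664 (pairing), Prop. 3.9 (3.73) p.665 (rate shape); Balaban1984PropagatorsII, (2.52)–(2.55) p.232, (2.133) p.247] -/
theorem sf_idef_bgradCov_cvGlued (hL : Odd L ∧ 1 < L) (hL7 : 7 ≤ L) {a : ℝ} (ha : 0 < a) (ι : Type) [Fintype ι] [DecidableEq ι] :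
    ∃ δ w₀ R₀ D : ℝ, 0 < δ ∧ 0 < R₀ ∧
      ∀ (mv kk r : ℕ) (ν : Fin (d + 1)), 1 ≤ kk → w₀ ≤ ((L ^ mv : ℕ) : ℝ) →
      ∀ {mm : Type} [Fintype mm] [DecidableEq mm] (e : Matrix mm mm ℂ ≃L[ℝ] (ι → ℝ)), (∀ A B : Matrix mm mm ℂ, traceForm A B = e A ⬝ᵥ e B) →
      ∀ (A' : Fin (d + 1) → CvX' d L mv kk r hL → Matrix mm mm ℂ), (∀ μ x', (A' μ x')ᴴ = -A' μ x') →
      ∀ (rA : ℝ), 0 ≤ rA → (∀ μ x', ‖A' μ x'‖ ≤ rA) →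
        (∀ μ κ x', ‖A' μ ((bshiftEquiv (cvM d L mv kk hL) (L ^ r * L ^ kk)) κ x') - A' μ x'‖ ≤ rA * ((((L ^ r * L ^ kk : ℕ) : ℝ))⁻¹)) →
        (∀ μ κ x', ‖(A' μ ((bshiftEquiv (cvM d L mv kk hL) (L ^ r * L ^ kk)) κ x') - A' μ x') -
            (A' μ ((bshiftEquiv (cvM d L mv kk hL) (L ^ r * L ^ kk)) κ (((bshiftEquiv (cvM d L mv kk hL) (L ^ r * L ^ kk)) μ).symm x')) - A' μ (((bshiftEquiv (cvM d L mv kk hL) (L ^ r * L ^ kk)) μ).symm x'))‖ ≤ rA * ((((L ^ r * L ^ kk : ℕ) : ℝ))⁻¹) * ((((L ^ r * L ^ kk : ℕ) : ℝ))⁻¹)) →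
        2 * ((1 + Fintype.card (Fin (d + 1))) * ((3 + 2 * ((d : ℝ) + 1)) * rA)) ≤ 1 →
        (14 * Real.exp 1 * (1 + Fintype.card (Fin (d + 1))) * basisConst e * ((1 + Fintype.card (Fin (d + 1))) * ((3 + 2 * ((d : ℝ) + 1)) * rA))) * (1 + Fintype.card (Fin (d + 1) ⊕ Fin (d + 1))) ≤ R₀ →
        HasMaj (CvNorm d L mv kk hL ι) (BlockNorm.ofBlocks (unitTorusGeo L kk (cvM d L mv kk hL)) (liftBlk (cvBlk d L mv kk hL ∘ (kingPrV L kk r (cvM d L mv kk hL))) ι))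
          (idef (pull (liftMap (kingPrV L kk r (cvM d L mv kk hL)) ι)) (pull (liftMap (kingPrV L kk r (cvM d L mv kk hL)) ι))
            ((cvGlued' d L mv kk r hL a ((((L ^ r * L ^ kk : ℕ) : ℝ))⁻¹) ι e (fun _ _ => (1 : Matrix mm mm ℂ)) (fun μ x' => NormedSpace.exp (((((L ^ r * L ^ kk : ℕ) : ℝ))⁻¹) • A' μ x')) (cvNL' d L mv kk r hL a ι) (fun _ => 0)) ∘ₗ covD ((((L ^ r * L ^ kk : ℕ) : ℝ))⁻¹) ((gaugePair (bshiftEquiv (cvM d L mv kk hL) (L ^ r * L ^ kk)) (fun μ x' => coordMat e (ContinuousLinearMap.mulLeftRight ℝ (Matrix mm mm ℂ) (NormedSpace.exp (((((L ^ r * L ^ kk : ℕ) : ℝ))⁻¹) • A' μ x')) (NormedSpace.exp (((((L ^ r * L ^ kk : ℕ) : ℝ))⁻¹) • A' μ x'))ᴴ))) (Sum.inr ν)) ((bshiftEquiv (cvM d L mv kk hL) (L ^ r * L ^ kk)) ν).symm)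
            ((cvGlued d L mv kk hL a ((((L ^ kk : ℕ) : ℝ))⁻¹) ι e (fun _ _ => (1 : Matrix mm mm ℂ)) (fun μ x => NormedSpace.exp (((((L ^ kk : ℕ) : ℝ))⁻¹) • gavgM (Matrix mm mm ℂ) (Fin (d + 1)) (kingPrV L kk r (cvM d L mv kk hL)) A' μ x)) (cvNL d L mv kk hL a ι) (fun _ => 0)) ∘ₗ covD ((((L ^ kk : ℕ) : ℝ))⁻¹) ((gaugePair (bshiftEquiv (cvM d L mv kk hL) (L ^ kk)) (fun μ x => coordMat e (ContinuousLinearMap.mulLeftRight ℝ (Matrix mm mm ℂ) (NormedSpace.exp (((((L ^ kk : ℕ) : ℝ))⁻¹) • gavgM (Matrix mm mm ℂ) (Fin (d + 1)) (kingPrV L kk r (cvM d L mv kk hL)) A' μ x)) (NormedSpace.exp (((((L ^ kk : ℕ) : ℝ))⁻¹) • gavgM (Matrix mm mm ℂ) (Fin (d + 1)) (kingPrV L kk r (cvM d L mv kk hL)) A' μ x))ᴴ))) (Sum.inr ν)) ((bshiftEquiv (cvM d L mv kk hL) (L ^ kk)) ν).symm))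
          (fun y y' => D * ((((L ^ kk : ℕ) : ℝ)) ^ (-(1 / 16 : ℝ)) + (((L ^ kk : ℕ) : ℝ)) ^ (-(1 / (8 * ((d : ℝ) + 1)))) + (14 * Real.exp 1 * (1 + Fintype.card (Fin (d + 1))) * basisConst e * ((1 + Fintype.card (Fin (d + 1))) * ((3 + 2 * ((d : ℝ) + 1)) * rA))) * (1 + Fintype.card (Fin (d + 1) ⊕ Fin (d + 1))) * ((((L ^ kk : ℕ) : ℝ))⁻¹)) * Real.exp (-(δ * (unitTorusGeo L kk (cvM d L mv kk hL)).dist y y'))) := by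
  have hLpos : 0 < L := Nat.pos_of_ne_zero (NeZero.ne L)
  obtain ⟨δJ, wJ, RJ, DJ, hδJ, hRJ, hDJ, HJ⟩ := sf_idef_bgrad_cvGlued (d := d) hL hL7 ha ι
  obtain ⟨δ1, w1, R1, B1, hδ1, hR1, hB1, H1⟩ := sf_bgrad_cvGlued'_spec (d := d) hL hL7 ha ι
  obtain ⟨δ0, w0, R0, D0, hδ0, hR0, H0⟩ := sf_idef_cvGlued (d := d) hL hL7 ha ι
  obtain ⟨δP, wP, RP, BP, hδP, hRP, hBP, HP⟩ := sf_cvGlued_pair_spec (d := d) hL hL7 ha ι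
  let ρ : ℝ := min (min (δJ / 16) δ1) (min (δ0 / 16) δP)
  have hρ : 0 < ρ := lt_min (lt_min (by positivity) hδ1) (lt_min (by positivity) hδP)
  have hρJ : ρ ≤ δJ / 16 := (min_le_left _ _).trans (min_le_left _ _)
  have hρ1 : ρ ≤ δ1 := (min_le_left _ _).trans (min_le_right _ _)
  have hρ0 : ρ ≤ δ0 / 16 := (min_le_right _ _).trans (min_le_left _ _)
  have hρP : ρ ≤ δP := (min_le_right _ _).trans (min_le_right _ _)
  let Rm : ℝ := min (min RJ R1) (min R0 RP)
  have hRm : 0 < Rm := lt_min (lt_min hRJ hR1) (lt_min hR0 hRP)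
  let Dc : ℝ := (2 * B1 + (1 + Rm) * max DJ 0) + (2 * BP + Rm * max D0 0) + (BP + Rm * max D0 0)
  refine ⟨ρ, max (max wJ w1) (max w0 wP), Rm, Dc, hρ, hRm, fun mv kk r ν hk hw₀ => ?_⟩
  intro mm _ _ e he A' hA' rA hrA h1 h2 h3 hr2 hRle
  have hwJ : wJ ≤ ((L ^ mv : ℕ) : ℝ) := ((le_max_left _ _).trans (le_max_left _ _)).trans hw₀
  have hw1 : w1 ≤ ((L ^ mv : ℕ) : ℝ) := ((le_max_right _ _).trans (le_max_left _ _)).trans hw₀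
  have hw0 : w0 ≤ ((L ^ mv : ℕ) : ℝ) := ((le_max_left _ _).trans (le_max_right _ _)).trans hw₀
  have hwP : wP ≤ ((L ^ mv : ℕ) : ℝ) := ((le_max_right _ _).trans (le_max_right _ _)).trans hw₀
  have hRleJ := hRle.trans ((min_le_left _ _).trans (min_le_left _ _))
  have hRle1 := hRle.trans ((min_le_left _ _).trans (min_le_right _ _))
  have hRle0 := hRle.trans ((min_le_right _ _).trans (min_le_left _ _))
  have hRleP := hRle.trans ((min_le_right _ _).trans (min_le_right _ _))
  -- the two spacings
  have hkpos : (0 : ℝ) < ((L ^ kk : ℕ) : ℝ) := Nat.cast_pos.mpr (pow_pos hLpos kk)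
  have hrkpos : (0 : ℝ) < ((L ^ r * L ^ kk : ℕ) : ℝ) := Nat.cast_pos.mpr (Nat.mul_pos (pow_pos hLpos r) (pow_pos hLpos kk))
  have hη : (0 : ℝ) < ((((L ^ kk : ℕ) : ℝ))⁻¹) := inv_pos.mpr hkpos
  have hη' : (0 : ℝ) < ((((L ^ r * L ^ kk : ℕ) : ℝ))⁻¹) := inv_pos.mpr hrkpos
  have hN : ((((L ^ kk : ℕ) : ℝ))⁻¹) = ((L ^ r : ℕ) : ℝ) * ((((L ^ r * L ^ kk : ℕ) : ℝ))⁻¹) := by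
    have hr0 : ((L ^ r : ℕ) : ℝ) ≠ 0 := Nat.cast_ne_zero.mpr (pow_ne_zero _ (NeZero.ne L))
    rw [Nat.cast_mul]; field_simp
  have hη1 : ((((L ^ kk : ℕ) : ℝ))⁻¹) ≤ 1 := inv_le_one_of_one_le₀ (by exact_mod_cast Nat.one_le_pow kk L hLpos)
  have hη'η : ((((L ^ r * L ^ kk : ℕ) : ℝ))⁻¹) ≤ ((((L ^ kk : ℕ) : ℝ))⁻¹) := inv_anti₀ hkpos (by exact_mod_cast Nat.le_mul_of_pos_left _ (pow_pos hLpos r))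
  have hη'1 : ((((L ^ r * L ^ kk : ℕ) : ℝ))⁻¹) ≤ 1 := hη'η.trans hη1
  have hC₀ : (0 : ℝ) ≤ 2 * ((d : ℝ) + 1) := by positivity
  have hCθ : ((2 * ((d + 1) * (L ^ r - 1)) : ℕ) : ℝ) * ((((L ^ r * L ^ kk : ℕ) : ℝ))⁻¹) ≤ 2 * ((d : ℝ) + 1) * ((((L ^ kk : ℕ) : ℝ))⁻¹) := by
    have hsub : (((L ^ r - 1 : ℕ)) : ℝ) ≤ ((L ^ r : ℕ) : ℝ) := by exact_mod_cast Nat.sub_le _ _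
    have hcast : ((2 * ((d + 1) * (L ^ r - 1)) : ℕ) : ℝ) = 2 * ((d : ℝ) + 1) * (((L ^ r - 1 : ℕ)) : ℝ) := by push_cast; ring
    rw [hcast, hN]
    calc 2 * ((d : ℝ) + 1) * (((L ^ r - 1 : ℕ)) : ℝ) * ((((L ^ r * L ^ kk : ℕ) : ℝ))⁻¹) ≤ 2 * ((d : ℝ) + 1) * ((L ^ r : ℕ) : ℝ) * ((((L ^ r * L ^ kk : ℕ) : ℝ))⁻¹) :=
          mul_le_mul_of_nonneg_right (mul_le_mul_of_nonneg_left hsub hC₀) hη'.le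
      _ = 2 * ((d : ℝ) + 1) * (((L ^ r : ℕ) : ℝ) * ((((L ^ r * L ^ kk : ℕ) : ℝ))⁻¹)) := by ring
  -- King's pairing geometry and skewness in coordinates; the transporter fields are `expTrField`s
  have hcomm := fun μ κ (x : CvX' d L mv kk r hL) => bshiftEquiv_comm (cvM d L mv kk hL) (L ^ r * L ^ kk) μ κ x
  have hconn := fun (f : CvX' d L mv kk r hL → Matrix mm mm ℂ) (β : ℝ)
      (hf : ∀ κ x, ‖f ((bshiftEquiv (cvM d L mv kk hL) (L ^ r * L ^ kk)) κ x) - f x‖ ≤ β) => fibre_conn_kingPrV L kk r (cvM d L mv kk hL) f β hf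
  have hblk := fun μ (x' : CvX' d L mv kk r hL) => kingPrV_bshiftEquiv_pow L kk r (cvM d L mv kk hL) μ x'
  have hAm : ∀ μ x, (gavgM (Matrix mm mm ℂ) (Fin (d + 1)) (kingPrV L kk r (cvM d L mv kk hL)) A' μ x)ᴴ = -gavgM (Matrix mm mm ℂ) (Fin (d + 1)) (kingPrV L kk r (cvM d L mv kk hL)) A' μ x := gavgM_conjTranspose_of_skew (kingPrV L kk r (cvM d L mv kk hL)) hA'
  have hA'c := fun μ x' => coordMat_adCLM_transpose_eq_neg_of_conjTranspose e he (hA' μ x')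
  have hAmc := fun μ x => coordMat_adCLM_transpose_eq_neg_of_conjTranspose e he (hAm μ x)
  obtain ⟨-, hcA, -, hcA', -, hfA, -, -, hgb, hgb', -, -, -, hfbT, hfgb⟩ :=
    twoSidedLetters_curvCoef_one_of_meanGauge e (π := (kingPrV L kk r (cvM d L mv kk hL))) (s := (bshiftEquiv (cvM d L mv kk hL) (L ^ kk))) (s' := (bshiftEquiv (cvM d L mv kk hL) (L ^ r * L ^ kk))) (N := L ^ r) (θ := ((((L ^ kk : ℕ) : ℝ))⁻¹)) (Cπ := ((2 * ((d + 1) * (L ^ r - 1)) : ℕ) : ℝ)) (C₀ := 2 * ((d : ℝ) + 1))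
      hcomm hconn hblk hη' hN hη hη1 le_rfl hC₀ hCθ hrA hr2 hA'c hAmc h1 h2 h3
  rw [curvCoefA_one, ← exp_eq_expTrField e ((((L ^ kk : ℕ) : ℝ))⁻¹) hAm] at hcA hgb
  rw [curvCoefA_one, ← exp_eq_expTrField e ((((L ^ r * L ^ kk : ℕ) : ℝ))⁻¹) hA'] at hcA' hgb'
  rw [curvCoefA_one, curvCoefA_one, ← exp_eq_expTrField e ((((L ^ kk : ℕ) : ℝ))⁻¹) hAm, ← exp_eq_expTrField e ((((L ^ r * L ^ kk : ℕ) : ℝ))⁻¹) hA'] at hfA hfbT hfgb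
  -- the scale letter
  have hκ0 : 0 ≤ basisConst e := basisConst_nonneg e
  have hS0 : 0 ≤ (14 * Real.exp 1 * (1 + Fintype.card (Fin (d + 1))) * basisConst e * ((1 + Fintype.card (Fin (d + 1))) * ((3 + 2 * ((d : ℝ) + 1)) * rA))) := by positivity
  have hJJ1 : (1 : ℝ) ≤ (1 + Fintype.card (Fin (d + 1) ⊕ Fin (d + 1))) := le_add_of_nonneg_right (Nat.cast_nonneg _)
  have hJJ0 : (0 : ℝ) ≤ (1 + Fintype.card (Fin (d + 1) ⊕ Fin (d + 1))) := zero_le_one.trans hJJ1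
  have hSRm : (14 * Real.exp 1 * (1 + Fintype.card (Fin (d + 1))) * basisConst e * ((1 + Fintype.card (Fin (d + 1))) * ((3 + 2 * ((d : ℝ) + 1)) * rA))) ≤ Rm := (le_mul_of_one_le_right hS0 hJJ1).trans hRle
  -- the transporters `R⁻ = 1 − η·a⁻`: rows of `R⁻∘τ`, `∇R⁻`, `a⁻` and their fits
  have hRc : ∀ x, (gaugePair (bshiftEquiv (cvM d L mv kk hL) (L ^ kk)) (fun μ x => coordMat e (ContinuousLinearMap.mulLeftRight ℝ (Matrix mm mm ℂ) (NormedSpace.exp (((((L ^ kk : ℕ) : ℝ))⁻¹) • gavgM (Matrix mm mm ℂ) (Fin (d + 1)) (kingPrV L kk r (cvM d L mv kk hL)) A' μ x)) (NormedSpace.exp (((((L ^ kk : ℕ) : ℝ))⁻¹) • gavgM (Matrix mm mm ℂ) (Fin (d + 1)) (kingPrV L kk r (cvM d L mv kk hL)) A' μ x))ᴴ))) (Sum.inr ν) x = 1 - ((((L ^ kk : ℕ) : ℝ))⁻¹) • tCoefA ((((L ^ kk : ℕ) : ℝ))⁻¹) (gaugePair (bshiftEquiv (cvM d L mv kk hL)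 (L ^ kk)) (fun μ x => coordMat e (ContinuousLinearMap.mulLeftRight ℝ (Matrix mm mm ℂ) (NormedSpace.exp (((((L ^ kk : ℕ) : ℝ))⁻¹) • gavgM (Matrix mm mm ℂ) (Fin (d + 1)) (kingPrV L kk r (cvM d L mv kk hL)) A' μ x)) (NormedSpace.exp (((((L ^ kk : ℕ) : ℝ))⁻¹) • gavgM (Matrix mm mm ℂ) (Fin (d + 1)) (kingPrV L kk r (cvM d L mv kk hL)) A' μ x))ᴴ))) (Sum.inr ν) x := fun x => transport_inr_eq (bshiftEquiv (cvM d L mv kk hL) (L ^ kk)) (fun μ x => coordMat e (ContinuousLinearMap.mulLeftRight ℝ (Matrix mm mm ℂ) (NormedSpace.exp (((((L ^ kk : ℕ) : ℝ))⁻¹) • gavgM (Matrix mm mm ℂ) (Fin (d + 1)) (kingPrV L kk r (cvM d L mv kk hL)) A' μ x)) (NormedSpace.exp (((((L ^ kk : ℕ) : ℝ))⁻¹) • gavgM (Matrix mm mm ℂ) (Fin (d + 1)) (kingPrV L kk r (cvM d L mv kk hL)) A' μ x))ᴴ)) ((((L ^ kk : ℕ) : ℝ))⁻¹) hη.ne'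 ν x
  have hRf : ∀ x', (gaugePair (bshiftEquiv (cvM d L mv kk hL) (L ^ r * L ^ kk)) (fun μ x' => coordMat e (ContinuousLinearMap.mulLeftRight ℝ (Matrix mm mm ℂ) (NormedSpace.exp (((((L ^ r * L ^ kk : ℕ) : ℝ))⁻¹) • A' μ x')) (NormedSpace.exp (((((L ^ r * L ^ kk : ℕ) : ℝ))⁻¹) • A' μ x'))ᴴ))) (Sum.inr ν) x' = 1 - ((((L ^ r * L ^ kk : ℕ) : ℝ))⁻¹) • tCoefA ((((L ^ r * L ^ kk : ℕ) : ℝ))⁻¹) (gaugePair (bshiftEquiv (cvM d L mv kk hL) (L ^ r * L ^ kk)) (fun μ x' => coordMat e (ContinuousLinearMap.mulLeftRight ℝ (Matrix mm mm ℂ) (NormedSpace.exp (((((L ^ r * L ^ kk : ℕ) : ℝ))⁻¹) • A' μ x')) (NormedSpace.exp (((((L ^ r * L ^ kk : ℕ) : ℝ))⁻¹) • A' μ x'))ᴴ))) (Sum.inr ν) x' := fun x' => transport_inr_eq (bshiftEquiv (cvM d L mv kk hL) (L ^ r * L ^ kk)) (fun μ x' => coordMat e (ContinuousLinearMap.mulLeftRight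 ℝ (Matrix mm mm ℂ) (NormedSpace.exp (((((L ^ r * L ^ kk : ℕ) : ℝ))⁻¹) • A' μ x')) (NormedSpace.exp (((((L ^ r * L ^ kk : ℕ) : ℝ))⁻¹) • A' μ x'))ᴴ)) ((((L ^ r * L ^ kk : ℕ) : ℝ))⁻¹) hη'.ne' ν x'
  have hRcf : (gaugePair (bshiftEquiv (cvM d L mv kk hL) (L ^ kk)) (fun μ x => coordMat e (ContinuousLinearMap.mulLeftRight ℝ (Matrix mm mm ℂ) (NormedSpace.exp (((((L ^ kk : ℕ) : ℝ))⁻¹) • gavgM (Matrix mm mm ℂ) (Fin (d + 1)) (kingPrV L kk r (cvM d L mv kk hL)) A' μ x)) (NormedSpace.exp (((((L ^ kk : ℕ) : ℝ))⁻¹) • gavgM (Matrix mm mm ℂ) (Fin (d + 1)) (kingPrV L kk r (cvM d L mv kk hL)) A' μ x))ᴴ))) (Sum.inr ν) = fun x => 1 - ((((L ^ kk : ℕ) : ℝ))⁻¹) • tCoefA ((((L ^ kk : ℕ) : ℝ))⁻¹) (gaugePair (bshiftEquiv (cvM d L mv kk hL) (L ^ kk)) (fun μ x => coordMat e (ContinuousLinearMap.mulLeftRight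 ℝ (Matrix mm mm ℂ) (NormedSpace.exp (((((L ^ kk : ℕ) : ℝ))⁻¹) • gavgM (Matrix mm mm ℂ) (Fin (d + 1)) (kingPrV L kk r (cvM d L mv kk hL)) A' μ x)) (NormedSpace.exp (((((L ^ kk : ℕ) : ℝ))⁻¹) • gavgM (Matrix mm mm ℂ) (Fin (d + 1)) (kingPrV L kk r (cvM d L mv kk hL)) A' μ x))ᴴ))) (Sum.inr ν) x := funext hRc
  have hRff : (gaugePair (bshiftEquiv (cvM d L mv kk hL) (L ^ r * L ^ kk)) (fun μ x' => coordMat e (ContinuousLinearMap.mulLeftRight ℝ (Matrix mm mm ℂ) (NormedSpace.exp (((((L ^ r * L ^ kk : ℕ) : ℝ))⁻¹) • A' μ x')) (NormedSpace.exp (((((L ^ r * L ^ kk : ℕ) : ℝ))⁻¹) • A' μ x'))ᴴ))) (Sum.inr ν) = fun x' => 1 - ((((L ^ r * L ^ kk : ℕ) : ℝ))⁻¹) • tCoefA ((((L ^ r * L ^ kk : ℕ) : ℝ))⁻¹) (gaugePair (bshiftEquiv (cvM d L mv kk hL) (L ^ r * L ^ kk)) (fun μ x' => coordMat e (ContinuousLinearMap.mulLeftRight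 ℝ (Matrix mm mm ℂ) (NormedSpace.exp (((((L ^ r * L ^ kk : ℕ) : ℝ))⁻¹) • A' μ x')) (NormedSpace.exp (((((L ^ r * L ^ kk : ℕ) : ℝ))⁻¹) • A' μ x'))ᴴ))) (Sum.inr ν) x' := funext hRf
  have hRrow : ∀ x i, ∑ k, |((gaugePair (bshiftEquiv (cvM d L mv kk hL) (L ^ kk)) (fun μ x => coordMat e (ContinuousLinearMap.mulLeftRight ℝ (Matrix mm mm ℂ) (NormedSpace.exp (((((L ^ kk : ℕ) : ℝ))⁻¹) • gavgM (Matrix mm mm ℂ) (Fin (d + 1)) (kingPrV L kk r (cvM d L mv kk hL)) A' μ x)) (NormedSpace.exp (((((L ^ kk : ℕ) : ℝ))⁻¹) • gavgM (Matrix mm mm ℂ) (Fin (d + 1)) (kingPrV L kk r (cvM d L mv kk hL)) A' μ x))ᴴ))) (Sum.inr ν) ∘ ⇑((bshiftEquiv (cvM d L mv kk hL) (L ^ kk)) ν)) x i k| ≤ 1 + ((((L ^ kk : ℕ) : ℝ))⁻¹) * (14 * Real.exp 1 * (1 + Fintype.card (Fin (d + 1))) * basisConst e * ((1 + Fintype.card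 (Fin (d + 1))) * ((3 + 2 * ((d : ℝ) + 1)) * rA))) := fun x i => by
    rw [Function.comp_apply, hRc]; exact rowSum_one_sub_smul_le hη.le (hcA (Sum.inr ν) _ i)
  have hRfit : ∀ x' i, ∑ k, |((gaugePair (bshiftEquiv (cvM d L mv kk hL) (L ^ r * L ^ kk)) (fun μ x' => coordMat e (ContinuousLinearMap.mulLeftRight ℝ (Matrix mm mm ℂ) (NormedSpace.exp (((((L ^ r * L ^ kk : ℕ) : ℝ))⁻¹) • A' μ x')) (NormedSpace.exp (((((L ^ r * L ^ kk : ℕ) : ℝ))⁻¹) • A' μ x'))ᴴ))) (Sum.inr ν) ∘ ⇑((bshiftEquiv (cvM d L mv kk hL) (L ^ r * L ^ kk)) ν)) x' i k - ((gaugePair (bshiftEquiv (cvM d L mv kk hL) (L ^ kk)) (fun μ x => coordMat e (ContinuousLinearMap.mulLeftRight ℝ (Matrix mm mm ℂ) (NormedSpace.exp (((((L ^ kk : ℕ) : ℝ))⁻¹) • gavgM (Matrix mm mm ℂ) (Fin (d + 1)) (kingPrV L kk r (cvM d L mv kk hL)) A' μ x)) (NormedSpace.exp (((((L ^ kk : ℕ)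 : ℝ))⁻¹) • gavgM (Matrix mm mm ℂ) (Fin (d + 1)) (kingPrV L kk r (cvM d L mv kk hL)) A' μ x))ᴴ))) (Sum.inr ν) ∘ ⇑((bshiftEquiv (cvM d L mv kk hL) (L ^ kk)) ν)) ((kingPrV L kk r (cvM d L mv kk hL)) x') i k| ≤ ((((L ^ r * L ^ kk : ℕ) : ℝ))⁻¹) * ((14 * Real.exp 1 * (1 + Fintype.card (Fin (d + 1))) * basisConst e * ((1 + Fintype.card (Fin (d + 1))) * ((3 + 2 * ((d : ℝ) + 1)) * rA))) * ((((L ^ kk : ℕ) : ℝ))⁻¹)) + |((((L ^ r * L ^ kk : ℕ) : ℝ))⁻¹) - ((((L ^ kk : ℕ) : ℝ))⁻¹)| * (14 * Real.exp 1 * (1 + Fintype.card (Fin (d + 1))) * basisConst e * ((1 + Fintype.card (Fin (d + 1))) * ((3 + 2 * ((d : ℝ) + 1)) * rA))) := fun x' i => by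
    rw [Function.comp_apply, Function.comp_apply, hRf, hRc]
    exact rowFit_one_sub_smul_le hη'.le (hcA (Sum.inr ν) _ i) (hfbT ν x' i)
  have hDrow : ∀ x i, ∑ k, |fgradMat ((((L ^ kk : ℕ) : ℝ))⁻¹)⁻¹ ((bshiftEquiv (cvM d L mv kk hL) (L ^ kk)) ν) ((gaugePair (bshiftEquiv (cvM d L mv kk hL) (L ^ kk)) (fun μ x => coordMat e (ContinuousLinearMap.mulLeftRight ℝ (Matrix mm mm ℂ) (NormedSpace.exp (((((L ^ kk : ℕ) : ℝ))⁻¹) • gavgM (Matrix mm mm ℂ) (Fin (d + 1)) (kingPrV L kk r (cvM d L mv kk hL)) A' μ x)) (NormedSpace.exp (((((L ^ kk : ℕ) : ℝ))⁻¹) • gavgM (Matrix mm mm ℂ) (Fin (d + 1)) (kingPrV L kk r (cvM d L mv kk hL)) A' μ x))ᴴ))) (Sum.inr ν)) x i k| ≤ ((((L ^ kk : ℕ) : ℝ))⁻¹) * (14 * Real.exp 1 * (1 + Fintype.card (Fin (d + 1))) * basisConst e * ((1 + Fintype.card (Fin (d + 1))) * ((3 + 2 * ((d : ℝ) + 1))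 * rA))) := fun x i => by
    rw [hRcf]; simp only [fgradMat_one_sub_smul_apply]; exact rowSum_neg_mul_le hη.le (hgb ν x i)
  have hDfit : ∀ x' i, ∑ k, |fgradMat ((((L ^ r * L ^ kk : ℕ) : ℝ))⁻¹)⁻¹ ((bshiftEquiv (cvM d L mv kk hL) (L ^ r * L ^ kk)) ν) ((gaugePair (bshiftEquiv (cvM d L mv kk hL) (L ^ r * L ^ kk)) (fun μ x' => coordMat e (ContinuousLinearMap.mulLeftRight ℝ (Matrix mm mm ℂ) (NormedSpace.exp (((((L ^ r * L ^ kk : ℕ) : ℝ))⁻¹) • A' μ x')) (NormedSpace.exp (((((L ^ r * L ^ kk : ℕ) : ℝ))⁻¹) • A' μ x'))ᴴ))) (Sum.inr ν)) x' i k - fgradMat ((((L ^ kk : ℕ) : ℝ))⁻¹)⁻¹ ((bshiftEquiv (cvM d L mv kk hL) (L ^ kk)) ν) ((gaugePair (bshiftEquiv (cvM d L mv kk hL) (L ^ kk)) (fun μ x => coordMat e (ContinuousLinearMap.mulLeftRight ℝ (Matrix mm mm ℂ) (NormedSpace.exp (((((L ^ kk : ℕ) : ℝ))⁻¹) • gavgM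 (Matrix mm mm ℂ) (Fin (d + 1)) (kingPrV L kk r (cvM d L mv kk hL)) A' μ x)) (NormedSpace.exp (((((L ^ kk : ℕ) : ℝ))⁻¹) • gavgM (Matrix mm mm ℂ) (Fin (d + 1)) (kingPrV L kk r (cvM d L mv kk hL)) A' μ x))ᴴ))) (Sum.inr ν)) ((kingPrV L kk r (cvM d L mv kk hL)) x') i k| ≤ ((((L ^ r * L ^ kk : ℕ) : ℝ))⁻¹) * ((14 * Real.exp 1 * (1 + Fintype.card (Fin (d + 1))) * basisConst e * ((1 + Fintype.card (Fin (d + 1))) * ((3 + 2 * ((d : ℝ) + 1)) * rA))) * ((((L ^ kk : ℕ) : ℝ))⁻¹)) + |((((L ^ r * L ^ kk : ℕ) : ℝ))⁻¹) - ((((L ^ kk : ℕ) : ℝ))⁻¹)| * (14 * Real.exp 1 * (1 + Fintype.card (Fin (d + 1))) * basisConst e * ((1 + Fintype.card (Fin (d + 1))) * ((3 + 2 * ((d : ℝ) + 1)) * rA))) := fun x' i => by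
    rw [hRcf, hRff]; simp only [fgradMat_one_sub_smul_apply]; exact rowFit_neg_mul_le hη'.le (hgb ν _ i) (hfgb ν x' i)
  have hBrow : ∀ x i, ∑ k, |tCoefA ((((L ^ kk : ℕ) : ℝ))⁻¹) (gaugePair (bshiftEquiv (cvM d L mv kk hL) (L ^ kk)) (fun μ x => coordMat e (ContinuousLinearMap.mulLeftRight ℝ (Matrix mm mm ℂ) (NormedSpace.exp (((((L ^ kk : ℕ) : ℝ))⁻¹) • gavgM (Matrix mm mm ℂ) (Fin (d + 1)) (kingPrV L kk r (cvM d L mv kk hL)) A' μ x)) (NormedSpace.exp (((((L ^ kk : ℕ) : ℝ))⁻¹) • gavgM (Matrix mm mm ℂ) (Fin (d + 1)) (kingPrV L kk r (cvM d L mv kk hL)) A' μ x))ᴴ))) (Sum.inr ν) x i k| ≤ (14 * Real.exp 1 * (1 + Fintype.card (Fin (d + 1))) * basisConst e * ((1 + Fintype.card (Fin (d + 1))) * ((3 + 2 * ((d : ℝ) + 1)) * rA))) := fun x i => hcA (Sum.inr ν) x i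
  have hBfit : ∀ x' i, ∑ k, |tCoefA ((((L ^ r * L ^ kk : ℕ) : ℝ))⁻¹) (gaugePair (bshiftEquiv (cvM d L mv kk hL) (L ^ r * L ^ kk)) (fun μ x' => coordMat e (ContinuousLinearMap.mulLeftRight ℝ (Matrix mm mm ℂ) (NormedSpace.exp (((((L ^ r * L ^ kk : ℕ) : ℝ))⁻¹) • A' μ x')) (NormedSpace.exp (((((L ^ r * L ^ kk : ℕ) : ℝ))⁻¹) • A' μ x'))ᴴ))) (Sum.inr ν) x' i k - tCoefA ((((L ^ kk : ℕ) : ℝ))⁻¹) (gaugePair (bshiftEquiv (cvM d L mv kk hL) (L ^ kk)) (fun μ x => coordMat e (ContinuousLinearMap.mulLeftRight ℝ (Matrix mm mm ℂ) (NormedSpace.exp (((((L ^ kk : ℕ) : ℝ))⁻¹) • gavgM (Matrix mm mm ℂ) (Fin (d + 1)) (kingPrV L kk r (cvM d L mv kk hL)) A' μ x)) (NormedSpace.exp (((((L ^ kk : ℕ) : ℝ))⁻¹) • gavgM (Matrix mm mm ℂ) (Fin (d + 1)) (kingPrV L kk r (cvM d L mv kk hL)) A' μ x))ᴴ))) (Sum.inr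 ν) ((kingPrV L kk r (cvM d L mv kk hL)) x') i k| ≤ (14 * Real.exp 1 * (1 + Fintype.card (Fin (d + 1))) * basisConst e * ((1 + Fintype.card (Fin (d + 1))) * ((3 + 2 * ((d : ℝ) + 1)) * rA))) * ((((L ^ kk : ℕ) : ℝ))⁻¹) := fun x' i => hfA (Sum.inr ν) x' i
  -- the four operator inputs at the common rate `ρ`
  have hd0 := unitTorusGeo_dist_nonneg L kk (cvM d L mv kk hL)
  have hexp : ∀ (c : ℝ) (y y' : Tor (cvM d L mv kk hL)), ρ ≤ c → Real.exp (-(c * (unitTorusGeo L kk (cvM d L mv kk hL)).dist y y')) ≤ Real.exp (-(ρ * (unitTorusGeo L kk (cvM d L mv kk hL)).dist y y')) :=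
    fun c y y' hc => Real.exp_le_exp.mpr (neg_le_neg (mul_le_mul_of_nonneg_right hc (hd0 y y')))
  have hR0 : 0 ≤ ((((L ^ kk : ℕ) : ℝ)) ^ (-(1 / 16 : ℝ)) + (((L ^ kk : ℕ) : ℝ)) ^ (-(1 / (8 * ((d : ℝ) + 1)))) + (14 * Real.exp 1 * (1 + Fintype.card (Fin (d + 1))) * basisConst e * ((1 + Fintype.card (Fin (d + 1))) * ((3 + 2 * ((d : ℝ) + 1)) * rA))) * (1 + Fintype.card (Fin (d + 1) ⊕ Fin (d + 1))) * ((((L ^ kk : ℕ) : ℝ))⁻¹)) := by positivity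
  have hRJ0 : 0 ≤ (((L ^ kk : ℕ) : ℝ)) ^ (-(1 / 16 : ℝ)) + (((L ^ kk : ℕ) : ℝ)) ^ (-(1 / (8 * ((d : ℝ) + 1)))) + (14 * Real.exp 1 * (1 + Fintype.card (Fin (d + 1))) * basisConst e * ((1 + Fintype.card (Fin (d + 1))) * ((3 + 2 * ((d : ℝ) + 1)) * rA))) * ((((L ^ kk : ℕ) : ℝ))⁻¹) := by positivity
  have hRJle : (((L ^ kk : ℕ) : ℝ)) ^ (-(1 / 16 : ℝ)) + (((L ^ kk : ℕ) : ℝ)) ^ (-(1 / (8 * ((d : ℝ) + 1)))) + (14 * Real.exp 1 * (1 + Fintype.card (Fin (d + 1))) * basisConst e * ((1 + Fintype.card (Fin (d + 1))) * ((3 + 2 * ((d : ℝ) + 1)) * rA))) * ((((L ^ kk : ℕ) : ℝ))⁻¹) ≤ ((((L ^ kk : ℕ) : ℝ)) ^ (-(1 / 16 : ℝ)) + (((L ^ kk : ℕ) : ℝ)) ^ (-(1 / (8 * ((d : ℝ) + 1)))) + (14 * Real.exp 1 * (1 + Fintype.card (Fin (d + 1))) * basisConst e * ((1 + Fintype.card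 (Fin (d + 1))) * ((3 + 2 * ((d : ℝ) + 1)) * rA))) * (1 + Fintype.card (Fin (d + 1) ⊕ Fin (d + 1))) * ((((L ^ kk : ℕ) : ℝ))⁻¹)) := by
    have : (14 * Real.exp 1 * (1 + Fintype.card (Fin (d + 1))) * basisConst e * ((1 + Fintype.card (Fin (d + 1))) * ((3 + 2 * ((d : ℝ) + 1)) * rA))) * ((((L ^ kk : ℕ) : ℝ))⁻¹) ≤ (14 * Real.exp 1 * (1 + Fintype.card (Fin (d + 1))) * basisConst e * ((1 + Fintype.card (Fin (d + 1))) * ((3 + 2 * ((d : ℝ) + 1)) * rA))) * (1 + Fintype.card (Fin (d + 1) ⊕ Fin (d + 1))) * ((((L ^ kk : ℕ) : ℝ))⁻¹) := by rw [mul_assoc (14 * Real.exp 1 * (1 + Fintype.card (Fin (d + 1))) * basisConst e * ((1 + Fintype.card (Fin (d + 1))) * ((3 + 2 * ((d : ℝ) + 1)) * rA))) (1 + Fintype.card (Fin (d + 1) ⊕ Fin (d + 1)))]; exact mul_le_mul_of_nonneg_left (le_mul_of_one_le_left hη.le hJJ1) hS0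
    linarith only [this]
  have hR0le : (((L ^ kk : ℕ) : ℝ)) ^ (-(1 / 16 : ℝ)) + (14 * Real.exp 1 * (1 + Fintype.card (Fin (d + 1))) * basisConst e * ((1 + Fintype.card (Fin (d + 1))) * ((3 + 2 * ((d : ℝ) + 1)) * rA))) * (1 + Fintype.card (Fin (d + 1) ⊕ Fin (d + 1))) * ((((L ^ kk : ℕ) : ℝ))⁻¹) ≤ ((((L ^ kk : ℕ) : ℝ)) ^ (-(1 / 16 : ℝ)) + (((L ^ kk : ℕ) : ℝ)) ^ (-(1 / (8 * ((d : ℝ) + 1)))) + (14 * Real.exp 1 * (1 + Fintype.card (Fin (d + 1))) * basisConst e * ((1 + Fintype.card (Fin (d + 1))) * ((3 + 2 * ((d : ℝ) + 1)) * rA))) * (1 + Fintype.card (Fin (d + 1) ⊕ Fin (d + 1))) * ((((L ^ kk : ℕ) : ℝ))⁻¹)) := by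
    have : 0 ≤ (((L ^ kk : ℕ) : ℝ)) ^ (-(1 / (8 * ((d : ℝ) + 1)))) := by positivity
    linarith only [this]
  have hGD := (HJ mv kk r ν hk hwJ e he A' hA' rA hrA h1 h2 h3 hr2 hRleJ).mono fun y y' =>
    (mul_le_mul_of_nonneg_right (mul_le_mul (le_max_left DJ 0) hRJle hRJ0 (le_max_right _ _)) (Real.exp_nonneg _)).trans (mul_le_mul_of_nonneg_left (hexp _ y y' hρJ) (mul_nonneg (le_max_right _ _) hR0))
  have hGD' := (H1 mv kk r ν hk hw1 e he A' hA' rA hrA h1 h2 h3 hr2 hRle1).mono fun y y' => mul_le_mul_of_nonneg_left (hexp _ y y' hρ1) hB1.le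
  have hG0 := (H0 mv kk r hk hw0 e he A' hA' rA hrA h1 h2 h3 hr2 hRle0).mono fun y y' =>
    (mul_le_mul_of_nonneg_right (mul_le_mul (le_max_left D0 0) hR0le (by positivity) (le_max_right _ _)) (Real.exp_nonneg _)).trans (mul_le_mul_of_nonneg_left (hexp _ y y' hρ0) (mul_nonneg (le_max_right _ _) hR0))
  have hGP := (hasMaj_src_tgt_congr (liftBlk_blkCover_comp_kingPrV ι).symm (HP mv kk r hk hwP e he A' hA' rA hrA h1 h2 h3 hr2 hRleP).2.1).mono fun y y' => mul_le_mul_of_nonneg_left (hexp _ y y' hρP) hBP.le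
  -- FILE 159: the transport moves to the right; assemble
  have key := hasMaj_idef_gluedCovShape (g := (unitTorusGeo L kk (cvM d L mv kk hL))) (cvBlk d L mv kk hL) (kingPrV L kk r (cvM d L mv kk hL)) hBP.le hB1.le (mul_nonneg (le_max_right _ _) hR0) (mul_nonneg (le_max_right _ _) hR0)
    (by positivity) (by positivity) hS0 (by positivity) (by positivity) (by positivity) hRrow hDrow hBrow hRfit hDfit hBfit hGD' hGP hGD hG0
  rw [covD_transport_inr (bshiftEquiv (cvM d L mv kk hL) (L ^ r * L ^ kk)) ((((L ^ r * L ^ kk : ℕ) : ℝ))⁻¹) (gaugePair (bshiftEquiv (cvM d L mv kk hL) (L ^ r * L ^ kk)) (fun μ x' => coordMat e (ContinuousLinearMap.mulLeftRight ℝ (Matrix mm mm ℂ) (NormedSpace.exp (((((L ^ r * L ^ kk : ℕ) : ℝ))⁻¹) • A' μ x')) (NormedSpace.exp (((((L ^ r * L ^ kk : ℕ) : ℝ))⁻¹) • A' μ x'))ᴴ))) ν, covD_transport_inr (bshiftEquiv (cvM d L mv kk hL) (L ^ kk)) ((((L ^ kk : ℕ) : ℝ))⁻¹) (gaugePair (bshiftEquiv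 (cvM d L mv kk hL) (L ^ kk)) (fun μ x => coordMat e (ContinuousLinearMap.mulLeftRight ℝ (Matrix mm mm ℂ) (NormedSpace.exp (((((L ^ kk : ℕ) : ℝ))⁻¹) • gavgM (Matrix mm mm ℂ) (Fin (d + 1)) (kingPrV L kk r (cvM d L mv kk hL)) A' μ x)) (NormedSpace.exp (((((L ^ kk : ℕ) : ℝ))⁻¹) • gavgM (Matrix mm mm ℂ) (Fin (d + 1)) (kingPrV L kk r (cvM d L mv kk hL)) A' μ x))ᴴ))) ν, LinearMap.comp_neg, LinearMap.comp_neg, idef_neg_neg,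
    comp_covShape_bgrad_eq, comp_covShape_bgrad_eq]
  refine (key.mono fun y y' => ?_).neg
  -- the scalar bookkeeping
  have hE0 : 0 ≤ Real.exp (-(ρ * (unitTorusGeo L kk (cvM d L mv kk hL)).dist y y')) := Real.exp_nonneg _
  have hSη : (14 * Real.exp 1 * (1 + Fintype.card (Fin (d + 1))) * basisConst e * ((1 + Fintype.card (Fin (d + 1))) * ((3 + 2 * ((d : ℝ) + 1)) * rA))) * ((((L ^ kk : ℕ) : ℝ))⁻¹) ≤ ((((L ^ kk : ℕ) : ℝ)) ^ (-(1 / 16 : ℝ)) + (((L ^ kk : ℕ) : ℝ)) ^ (-(1 / (8 * ((d : ℝ) + 1)))) + (14 * Real.exp 1 * (1 + Fintype.card (Fin (d + 1))) * basisConst e * ((1 + Fintype.card (Fin (d + 1))) * ((3 + 2 * ((d : ℝ) + 1)) * rA))) * (1 + Fintype.card (Fin (d + 1) ⊕ Fin (d + 1))) * ((((L ^ kk : ℕ) : ℝ))⁻¹)) := by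
    have h2 : 0 ≤ (((L ^ kk : ℕ) : ℝ)) ^ (-(1 / 16 : ℝ)) + (((L ^ kk : ℕ) : ℝ)) ^ (-(1 / (8 * ((d : ℝ) + 1)))) := by positivity
    linarith only [hRJle, h2]
  have hηS1 : ((((L ^ kk : ℕ) : ℝ))⁻¹) * (14 * Real.exp 1 * (1 + Fintype.card (Fin (d + 1))) * basisConst e * ((1 + Fintype.card (Fin (d + 1))) * ((3 + 2 * ((d : ℝ) + 1)) * rA))) ≤ Rm := by
    calc ((((L ^ kk : ℕ) : ℝ))⁻¹) * (14 * Real.exp 1 * (1 + Fintype.card (Fin (d + 1))) * basisConst e * ((1 + Fintype.card (Fin (d + 1))) * ((3 + 2 * ((d : ℝ) + 1)) * rA))) ≤ 1 * (14 * Real.exp 1 * (1 + Fintype.card (Fin (d + 1))) * basisConst e * ((1 + Fintype.card (Fin (d + 1))) * ((3 + 2 * ((d : ℝ) + 1)) * rA))) := mul_le_mul_of_nonneg_right hη1 hS0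
      _ ≤ Rm := by rw [one_mul]; exact hSRm
  have hfit2 : ((((L ^ r * L ^ kk : ℕ) : ℝ))⁻¹) * ((14 * Real.exp 1 * (1 + Fintype.card (Fin (d + 1))) * basisConst e * ((1 + Fintype.card (Fin (d + 1))) * ((3 + 2 * ((d : ℝ) + 1)) * rA))) * ((((L ^ kk : ℕ) : ℝ))⁻¹)) + |((((L ^ r * L ^ kk : ℕ) : ℝ))⁻¹) - ((((L ^ kk : ℕ) : ℝ))⁻¹)| * (14 * Real.exp 1 * (1 + Fintype.card (Fin (d + 1))) * basisConst e * ((1 + Fintype.card (Fin (d + 1))) * ((3 + 2 * ((d : ℝ) + 1)) * rA))) ≤ 2 * ((((L ^ kk : ℕ) : ℝ)) ^ (-(1 / 16 : ℝ)) + (((L ^ kk : ℕ) : ℝ)) ^ (-(1 / (8 * ((d : ℝ) + 1)))) + (14 * Real.exp 1 * (1 + Fintype.card (Fin (d + 1))) * basisConst e * ((1 + Fintype.card (Fin (d + 1))) * ((3 + 2 * ((d : ℝ) + 1)) * rA))) * (1 + Fintype.card (Fin (d + 1) ⊕ Fin (d + 1))) * ((((L ^ kk : ℕ) : ℝ))⁻¹))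 := by
    have habs : |((((L ^ r * L ^ kk : ℕ) : ℝ))⁻¹) - ((((L ^ kk : ℕ) : ℝ))⁻¹)| ≤ ((((L ^ kk : ℕ) : ℝ))⁻¹) := by rw [abs_sub_comm, abs_of_nonneg (sub_nonneg.mpr hη'η)]; linarith only [hη'.le]
    have h1 : ((((L ^ r * L ^ kk : ℕ) : ℝ))⁻¹) * ((14 * Real.exp 1 * (1 + Fintype.card (Fin (d + 1))) * basisConst e * ((1 + Fintype.card (Fin (d + 1))) * ((3 + 2 * ((d : ℝ) + 1)) * rA))) * ((((L ^ kk : ℕ) : ℝ))⁻¹)) ≤ 1 * ((14 * Real.exp 1 * (1 + Fintype.card (Fin (d + 1))) * basisConst e * ((1 + Fintype.card (Fin (d + 1))) * ((3 + 2 * ((d : ℝ) + 1)) * rA))) * ((((L ^ kk : ℕ) : ℝ))⁻¹)) := mul_le_mul_of_nonneg_right hη'1 (mul_nonneg hS0 hη.le)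
    have h2 : |((((L ^ r * L ^ kk : ℕ) : ℝ))⁻¹) - ((((L ^ kk : ℕ) : ℝ))⁻¹)| * (14 * Real.exp 1 * (1 + Fintype.card (Fin (d + 1))) * basisConst e * ((1 + Fintype.card (Fin (d + 1))) * ((3 + 2 * ((d : ℝ) + 1)) * rA))) ≤ ((((L ^ kk : ℕ) : ℝ))⁻¹) * (14 * Real.exp 1 * (1 + Fintype.card (Fin (d + 1))) * basisConst e * ((1 + Fintype.card (Fin (d + 1))) * ((3 + 2 * ((d : ℝ) + 1)) * rA))) := mul_le_mul_of_nonneg_right habs hS0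
    nlinarith only [h1, h2, hSη, hS0, hη.le]
  have hT1 : B1 * (((((L ^ r * L ^ kk : ℕ) : ℝ))⁻¹) * ((14 * Real.exp 1 * (1 + Fintype.card (Fin (d + 1))) * basisConst e * ((1 + Fintype.card (Fin (d + 1))) * ((3 + 2 * ((d : ℝ) + 1)) * rA))) * ((((L ^ kk : ℕ) : ℝ))⁻¹)) + |((((L ^ r * L ^ kk : ℕ) : ℝ))⁻¹) - ((((L ^ kk : ℕ) : ℝ))⁻¹)| * (14 * Real.exp 1 * (1 + Fintype.card (Fin (d + 1))) * basisConst e * ((1 + Fintype.card (Fin (d + 1))) * ((3 + 2 * ((d : ℝ) + 1)) * rA)))) + max DJ 0 * ((((L ^ kk : ℕ) : ℝ)) ^ (-(1 / 16 : ℝ)) + (((L ^ kk : ℕ) : ℝ)) ^ (-(1 / (8 * ((d : ℝ) + 1)))) + (14 * Real.exp 1 * (1 + Fintype.card (Fin (d + 1))) * basisConst e * ((1 + Fintype.card (Fin (d + 1))) * ((3 + 2 * ((d : ℝ) + 1)) * rA))) * (1 + Fintype.card (Fin (d + 1) ⊕ Fin (d + 1))) * ((((L ^ kk : ℕ) : ℝ))⁻¹))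 * (1 + ((((L ^ kk : ℕ) : ℝ))⁻¹) * (14 * Real.exp 1 * (1 + Fintype.card (Fin (d + 1))) * basisConst e * ((1 + Fintype.card (Fin (d + 1))) * ((3 + 2 * ((d : ℝ) + 1)) * rA)))) ≤ (2 * B1 + (1 + Rm) * max DJ 0) * ((((L ^ kk : ℕ) : ℝ)) ^ (-(1 / 16 : ℝ)) + (((L ^ kk : ℕ) : ℝ)) ^ (-(1 / (8 * ((d : ℝ) + 1)))) + (14 * Real.exp 1 * (1 + Fintype.card (Fin (d + 1))) * basisConst e * ((1 + Fintype.card (Fin (d + 1))) * ((3 + 2 * ((d : ℝ) + 1)) * rA))) * (1 + Fintype.card (Fin (d + 1) ⊕ Fin (d + 1))) * ((((L ^ kk : ℕ) : ℝ))⁻¹)) := by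
    have a1 : B1 * (((((L ^ r * L ^ kk : ℕ) : ℝ))⁻¹) * ((14 * Real.exp 1 * (1 + Fintype.card (Fin (d + 1))) * basisConst e * ((1 + Fintype.card (Fin (d + 1))) * ((3 + 2 * ((d : ℝ) + 1)) * rA))) * ((((L ^ kk : ℕ) : ℝ))⁻¹)) + |((((L ^ r * L ^ kk : ℕ) : ℝ))⁻¹) - ((((L ^ kk : ℕ) : ℝ))⁻¹)| * (14 * Real.exp 1 * (1 + Fintype.card (Fin (d + 1))) * basisConst e * ((1 + Fintype.card (Fin (d + 1))) * ((3 + 2 * ((d : ℝ) + 1)) * rA)))) ≤ B1 * (2 * ((((L ^ kk : ℕ) : ℝ)) ^ (-(1 / 16 : ℝ)) + (((L ^ kk : ℕ) : ℝ)) ^ (-(1 / (8 * ((d : ℝ) + 1)))) + (14 * Real.exp 1 * (1 + Fintype.card (Fin (d + 1))) * basisConst e * ((1 + Fintype.card (Fin (d + 1))) * ((3 + 2 * ((d : ℝ) + 1)) * rA))) * (1 + Fintype.card (Fin (d + 1) ⊕ Fin (d + 1))) * ((((L ^ kk : ℕ) : ℝ))⁻¹))) := mul_le_mul_of_nonneg_left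 hfit2 hB1.le
    have a2 : max DJ 0 * ((((L ^ kk : ℕ) : ℝ)) ^ (-(1 / 16 : ℝ)) + (((L ^ kk : ℕ) : ℝ)) ^ (-(1 / (8 * ((d : ℝ) + 1)))) + (14 * Real.exp 1 * (1 + Fintype.card (Fin (d + 1))) * basisConst e * ((1 + Fintype.card (Fin (d + 1))) * ((3 + 2 * ((d : ℝ) + 1)) * rA))) * (1 + Fintype.card (Fin (d + 1) ⊕ Fin (d + 1))) * ((((L ^ kk : ℕ) : ℝ))⁻¹)) * (1 + ((((L ^ kk : ℕ) : ℝ))⁻¹) * (14 * Real.exp 1 * (1 + Fintype.card (Fin (d + 1))) * basisConst e * ((1 + Fintype.card (Fin (d + 1))) * ((3 + 2 * ((d : ℝ) + 1)) * rA)))) ≤ max DJ 0 * ((((L ^ kk : ℕ) : ℝ)) ^ (-(1 / 16 : ℝ)) + (((L ^ kk : ℕ) : ℝ)) ^ (-(1 / (8 * ((d : ℝ) + 1)))) + (14 * Real.exp 1 * (1 + Fintype.card (Fin (d + 1))) * basisConst e * ((1 + Fintype.card (Fin (d + 1))) * ((3 + 2 * ((d : ℝ) + 1)) * rA))) * (1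 + Fintype.card (Fin (d + 1) ⊕ Fin (d + 1))) * ((((L ^ kk : ℕ) : ℝ))⁻¹)) * (1 + Rm) := mul_le_mul_of_nonneg_left (by linarith only [hηS1]) (mul_nonneg (le_max_right _ _) hR0)
    nlinarith only [a1, a2]
  have hT2 : BP * (((((L ^ r * L ^ kk : ℕ) : ℝ))⁻¹) * ((14 * Real.exp 1 * (1 + Fintype.card (Fin (d + 1))) * basisConst e * ((1 + Fintype.card (Fin (d + 1))) * ((3 + 2 * ((d : ℝ) + 1)) * rA))) * ((((L ^ kk : ℕ) : ℝ))⁻¹)) + |((((L ^ r * L ^ kk : ℕ) : ℝ))⁻¹) - ((((L ^ kk : ℕ) : ℝ))⁻¹)| * (14 * Real.exp 1 * (1 + Fintype.card (Fin (d + 1))) * basisConst e * ((1 + Fintype.card (Fin (d + 1))) * ((3 + 2 * ((d : ℝ) + 1)) * rA)))) + max D0 0 * ((((L ^ kk : ℕ) : ℝ)) ^ (-(1 / 16 : ℝ)) + (((L ^ kk : ℕ) : ℝ)) ^ (-(1 / (8 * ((d : ℝ) + 1)))) + (14 * Real.exp 1 * (1 + Fintype.card (Fin (d + 1))) * basisConst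 e * ((1 + Fintype.card (Fin (d + 1))) * ((3 + 2 * ((d : ℝ) + 1)) * rA))) * (1 + Fintype.card (Fin (d + 1) ⊕ Fin (d + 1))) * ((((L ^ kk : ℕ) : ℝ))⁻¹)) * (((((L ^ kk : ℕ) : ℝ))⁻¹) * (14 * Real.exp 1 * (1 + Fintype.card (Fin (d + 1))) * basisConst e * ((1 + Fintype.card (Fin (d + 1))) * ((3 + 2 * ((d : ℝ) + 1)) * rA)))) ≤ (2 * BP + Rm * max D0 0) * ((((L ^ kk : ℕ) : ℝ)) ^ (-(1 / 16 : ℝ)) + (((L ^ kk : ℕ) : ℝ)) ^ (-(1 / (8 * ((d : ℝ) + 1)))) + (14 * Real.exp 1 * (1 + Fintype.card (Fin (d + 1))) * basisConst e * ((1 + Fintype.card (Fin (d + 1))) * ((3 + 2 * ((d : ℝ) + 1)) * rA))) * (1 + Fintype.card (Fin (d + 1) ⊕ Fin (d + 1))) * ((((L ^ kk : ℕ) : ℝ))⁻¹)) := by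
    have a1 : BP * (((((L ^ r * L ^ kk : ℕ) : ℝ))⁻¹) * ((14 * Real.exp 1 * (1 + Fintype.card (Fin (d + 1))) * basisConst e * ((1 + Fintype.card (Fin (d + 1))) * ((3 + 2 * ((d : ℝ) + 1)) * rA))) * ((((L ^ kk : ℕ) : ℝ))⁻¹)) + |((((L ^ r * L ^ kk : ℕ) : ℝ))⁻¹) - ((((L ^ kk : ℕ) : ℝ))⁻¹)| * (14 * Real.exp 1 * (1 + Fintype.card (Fin (d + 1))) * basisConst e * ((1 + Fintype.card (Fin (d + 1))) * ((3 + 2 * ((d : ℝ) + 1)) * rA)))) ≤ BP * (2 * ((((L ^ kk : ℕ) : ℝ)) ^ (-(1 / 16 : ℝ)) + (((L ^ kk : ℕ) : ℝ)) ^ (-(1 / (8 * ((d : ℝ) + 1)))) + (14 * Real.exp 1 * (1 + Fintype.card (Fin (d + 1))) * basisConst e * ((1 + Fintype.card (Fin (d + 1))) * ((3 + 2 * ((d : ℝ) + 1)) * rA))) * (1 + Fintype.card (Fin (d + 1) ⊕ Fin (d + 1))) * ((((L ^ kk : ℕ) : ℝ))⁻¹))) := mul_le_mul_of_nonneg_left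 hfit2 hBP.le
    have a2 : max D0 0 * ((((L ^ kk : ℕ) : ℝ)) ^ (-(1 / 16 : ℝ)) + (((L ^ kk : ℕ) : ℝ)) ^ (-(1 / (8 * ((d : ℝ) + 1)))) + (14 * Real.exp 1 * (1 + Fintype.card (Fin (d + 1))) * basisConst e * ((1 + Fintype.card (Fin (d + 1))) * ((3 + 2 * ((d : ℝ) + 1)) * rA))) * (1 + Fintype.card (Fin (d + 1) ⊕ Fin (d + 1))) * ((((L ^ kk : ℕ) : ℝ))⁻¹)) * (((((L ^ kk : ℕ) : ℝ))⁻¹) * (14 * Real.exp 1 * (1 + Fintype.card (Fin (d + 1))) * basisConst e * ((1 + Fintype.card (Fin (d + 1))) * ((3 + 2 * ((d : ℝ) + 1)) * rA)))) ≤ max D0 0 * ((((L ^ kk : ℕ) : ℝ)) ^ (-(1 / 16 : ℝ)) + (((L ^ kk : ℕ) : ℝ)) ^ (-(1 / (8 * ((d : ℝ) + 1)))) + (14 * Real.exp 1 * (1 + Fintype.card (Fin (d + 1))) * basisConst e * ((1 + Fintype.card (Fin (d + 1))) * ((3 + 2 * ((d : ℝ) + 1)) * rA))) * (1 + Fintype.card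 (Fin (d + 1) ⊕ Fin (d + 1))) * ((((L ^ kk : ℕ) : ℝ))⁻¹)) * Rm := mul_le_mul_of_nonneg_left hηS1 (mul_nonneg (le_max_right _ _) hR0)
    nlinarith only [a1, a2]
  have hT3 : BP * ((14 * Real.exp 1 * (1 + Fintype.card (Fin (d + 1))) * basisConst e * ((1 + Fintype.card (Fin (d + 1))) * ((3 + 2 * ((d : ℝ) + 1)) * rA))) * ((((L ^ kk : ℕ) : ℝ))⁻¹)) + max D0 0 * ((((L ^ kk : ℕ) : ℝ)) ^ (-(1 / 16 : ℝ)) + (((L ^ kk : ℕ) : ℝ)) ^ (-(1 / (8 * ((d : ℝ) + 1)))) + (14 * Real.exp 1 * (1 + Fintype.card (Fin (d + 1))) * basisConst e * ((1 + Fintype.card (Fin (d + 1))) * ((3 + 2 * ((d : ℝ) + 1)) * rA))) * (1 + Fintype.card (Fin (d + 1) ⊕ Fin (d + 1))) * ((((L ^ kk : ℕ) : ℝ))⁻¹)) * (14 * Real.exp 1 * (1 + Fintype.card (Fin (d + 1))) * basisConst e * ((1 + Fintype.card (Fin (d + 1))) * ((3 + 2 * ((d : ℝ) + 1)) * rA)))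 ≤ (BP + Rm * max D0 0) * ((((L ^ kk : ℕ) : ℝ)) ^ (-(1 / 16 : ℝ)) + (((L ^ kk : ℕ) : ℝ)) ^ (-(1 / (8 * ((d : ℝ) + 1)))) + (14 * Real.exp 1 * (1 + Fintype.card (Fin (d + 1))) * basisConst e * ((1 + Fintype.card (Fin (d + 1))) * ((3 + 2 * ((d : ℝ) + 1)) * rA))) * (1 + Fintype.card (Fin (d + 1) ⊕ Fin (d + 1))) * ((((L ^ kk : ℕ) : ℝ))⁻¹)) := by
    have a1 : BP * ((14 * Real.exp 1 * (1 + Fintype.card (Fin (d + 1))) * basisConst e * ((1 + Fintype.card (Fin (d + 1))) * ((3 + 2 * ((d : ℝ) + 1)) * rA))) * ((((L ^ kk : ℕ) : ℝ))⁻¹)) ≤ BP * ((((L ^ kk : ℕ) : ℝ)) ^ (-(1 / 16 : ℝ)) + (((L ^ kk : ℕ) : ℝ)) ^ (-(1 / (8 * ((d : ℝ) + 1)))) + (14 * Real.exp 1 * (1 + Fintype.card (Fin (d + 1))) * basisConst e * ((1 + Fintype.card (Fin (d + 1))) * ((3 + 2 * ((d : ℝ) + 1)) * rA))) * (1 + Fintype.card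 (Fin (d + 1) ⊕ Fin (d + 1))) * ((((L ^ kk : ℕ) : ℝ))⁻¹)) := mul_le_mul_of_nonneg_left hSη hBP.le
    have a2 : max D0 0 * ((((L ^ kk : ℕ) : ℝ)) ^ (-(1 / 16 : ℝ)) + (((L ^ kk : ℕ) : ℝ)) ^ (-(1 / (8 * ((d : ℝ) + 1)))) + (14 * Real.exp 1 * (1 + Fintype.card (Fin (d + 1))) * basisConst e * ((1 + Fintype.card (Fin (d + 1))) * ((3 + 2 * ((d : ℝ) + 1)) * rA))) * (1 + Fintype.card (Fin (d + 1) ⊕ Fin (d + 1))) * ((((L ^ kk : ℕ) : ℝ))⁻¹)) * (14 * Real.exp 1 * (1 + Fintype.card (Fin (d + 1))) * basisConst e * ((1 + Fintype.card (Fin (d + 1))) * ((3 + 2 * ((d : ℝ) + 1)) * rA))) ≤ max D0 0 * ((((L ^ kk : ℕ) : ℝ)) ^ (-(1 / 16 : ℝ)) + (((L ^ kk : ℕ) : ℝ)) ^ (-(1 / (8 * ((d : ℝ) + 1)))) + (14 * Real.exp 1 * (1 + Fintype.card (Fin (d + 1))) * basisConst e * ((1 + Fintype.card (Fin (d + 1)))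 * ((3 + 2 * ((d : ℝ) + 1)) * rA))) * (1 + Fintype.card (Fin (d + 1) ⊕ Fin (d + 1))) * ((((L ^ kk : ℕ) : ℝ))⁻¹)) * Rm := mul_le_mul_of_nonneg_left hSRm (mul_nonneg (le_max_right _ _) hR0)
    linarith only [a1, a2]
  calc (((B1 * (((((L ^ r * L ^ kk : ℕ) : ℝ))⁻¹) * ((14 * Real.exp 1 * (1 + Fintype.card (Fin (d + 1))) * basisConst e * ((1 + Fintype.card (Fin (d + 1))) * ((3 + 2 * ((d : ℝ) + 1)) * rA))) * ((((L ^ kk : ℕ) : ℝ))⁻¹)) + |((((L ^ r * L ^ kk : ℕ) : ℝ))⁻¹) - ((((L ^ kk : ℕ) : ℝ))⁻¹)| * (14 * Real.exp 1 * (1 + Fintype.card (Fin (d + 1))) * basisConst e * ((1 + Fintype.card (Fin (d + 1))) * ((3 + 2 * ((d : ℝ) + 1)) * rA)))) + max DJ 0 * ((((L ^ kk : ℕ) : ℝ)) ^ (-(1 / 16 : ℝ)) + (((L ^ kk : ℕ) : ℝ)) ^ (-(1 / (8 * ((d : ℝ) + 1)))) + (14 * Real.exp 1 * (1 + Fintype.card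 (Fin (d + 1))) * basisConst e * ((1 + Fintype.card (Fin (d + 1))) * ((3 + 2 * ((d : ℝ) + 1)) * rA))) * (1 + Fintype.card (Fin (d + 1) ⊕ Fin (d + 1))) * ((((L ^ kk : ℕ) : ℝ))⁻¹)) * (1 + ((((L ^ kk : ℕ) : ℝ))⁻¹) * (14 * Real.exp 1 * (1 + Fintype.card (Fin (d + 1))) * basisConst e * ((1 + Fintype.card (Fin (d + 1))) * ((3 + 2 * ((d : ℝ) + 1)) * rA))))) +
        (BP * (((((L ^ r * L ^ kk : ℕ) : ℝ))⁻¹) * ((14 * Real.exp 1 * (1 + Fintype.card (Fin (d + 1))) * basisConst e * ((1 + Fintype.card (Fin (d + 1))) * ((3 + 2 * ((d : ℝ) + 1)) * rA))) * ((((L ^ kk : ℕ) : ℝ))⁻¹)) + |((((L ^ r * L ^ kk : ℕ) : ℝ))⁻¹) - ((((L ^ kk : ℕ) : ℝ))⁻¹)| * (14 * Real.exp 1 * (1 + Fintype.card (Fin (d + 1))) * basisConst e * ((1 + Fintype.card (Fin (d + 1))) * ((3 + 2 * ((d : ℝ) + 1)) * rA)))) + max D0 0 * ((((L ^ kk : ℕ)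 : ℝ)) ^ (-(1 / 16 : ℝ)) + (((L ^ kk : ℕ) : ℝ)) ^ (-(1 / (8 * ((d : ℝ) + 1)))) + (14 * Real.exp 1 * (1 + Fintype.card (Fin (d + 1))) * basisConst e * ((1 + Fintype.card (Fin (d + 1))) * ((3 + 2 * ((d : ℝ) + 1)) * rA))) * (1 + Fintype.card (Fin (d + 1) ⊕ Fin (d + 1))) * ((((L ^ kk : ℕ) : ℝ))⁻¹)) * (((((L ^ kk : ℕ) : ℝ))⁻¹) * (14 * Real.exp 1 * (1 + Fintype.card (Fin (d + 1))) * basisConst e * ((1 + Fintype.card (Fin (d + 1))) * ((3 + 2 * ((d : ℝ) + 1)) * rA)))))) +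
        (BP * ((14 * Real.exp 1 * (1 + Fintype.card (Fin (d + 1))) * basisConst e * ((1 + Fintype.card (Fin (d + 1))) * ((3 + 2 * ((d : ℝ) + 1)) * rA))) * ((((L ^ kk : ℕ) : ℝ))⁻¹)) + max D0 0 * ((((L ^ kk : ℕ) : ℝ)) ^ (-(1 / 16 : ℝ)) + (((L ^ kk : ℕ) : ℝ)) ^ (-(1 / (8 * ((d : ℝ) + 1)))) + (14 * Real.exp 1 * (1 + Fintype.card (Fin (d + 1))) * basisConst e * ((1 + Fintype.card (Fin (d + 1))) * ((3 + 2 * ((d : ℝ) + 1)) * rA))) * (1 + Fintype.card (Fin (d + 1) ⊕ Fin (d + 1))) * ((((L ^ kk : ℕ) : ℝ))⁻¹)) * (14 * Real.exp 1 * (1 + Fintype.card (Fin (d + 1))) * basisConst e * ((1 + Fintype.card (Fin (d + 1))) * ((3 + 2 * ((d : ℝ) + 1)) * rA))))) * Real.exp (-(ρ * (unitTorusGeo L kk (cvM d L mv kk hL)).dist y y'))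
      ≤ (((2 * B1 + (1 + Rm) * max DJ 0) * ((((L ^ kk : ℕ) : ℝ)) ^ (-(1 / 16 : ℝ)) + (((L ^ kk : ℕ) : ℝ)) ^ (-(1 / (8 * ((d : ℝ) + 1)))) + (14 * Real.exp 1 * (1 + Fintype.card (Fin (d + 1))) * basisConst e * ((1 + Fintype.card (Fin (d + 1))) * ((3 + 2 * ((d : ℝ) + 1)) * rA))) * (1 + Fintype.card (Fin (d + 1) ⊕ Fin (d + 1))) * ((((L ^ kk : ℕ) : ℝ))⁻¹))) + ((2 * BP + Rm * max D0 0) * ((((L ^ kk : ℕ) : ℝ)) ^ (-(1 / 16 : ℝ)) + (((L ^ kk : ℕ) : ℝ)) ^ (-(1 / (8 * ((d : ℝ) + 1)))) + (14 * Real.exp 1 * (1 + Fintype.card (Fin (d + 1))) * basisConst e * ((1 + Fintype.card (Fin (d + 1))) * ((3 + 2 * ((d : ℝ) + 1)) * rA))) * (1 + Fintype.card (Fin (d + 1) ⊕ Fin (d + 1))) * ((((L ^ kk : ℕ) : ℝ))⁻¹))) + ((BP + Rm * max D0 0) * ((((L ^ kk : ℕ) : ℝ)) ^ (-(1 / 16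 : ℝ)) + (((L ^ kk : ℕ) : ℝ)) ^ (-(1 / (8 * ((d : ℝ) + 1)))) + (14 * Real.exp 1 * (1 + Fintype.card (Fin (d + 1))) * basisConst e * ((1 + Fintype.card (Fin (d + 1))) * ((3 + 2 * ((d : ℝ) + 1)) * rA))) * (1 + Fintype.card (Fin (d + 1) ⊕ Fin (d + 1))) * ((((L ^ kk : ℕ) : ℝ))⁻¹)))) * Real.exp (-(ρ * (unitTorusGeo L kk (cvM d L mv kk hL)).dist y y')) :=
        mul_le_mul_of_nonneg_right (add_le_add (add_le_add hT1 hT2) hT3) hE0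
    _ = Dc * ((((L ^ kk : ℕ) : ℝ)) ^ (-(1 / 16 : ℝ)) + (((L ^ kk : ℕ) : ℝ)) ^ (-(1 / (8 * ((d : ℝ) + 1)))) + (14 * Real.exp 1 * (1 + Fintype.card (Fin (d + 1))) * basisConst e * ((1 + Fintype.card (Fin (d + 1))) * ((3 + 2 * ((d : ℝ) + 1)) * rA))) * (1 + Fintype.card (Fin (d + 1) ⊕ Fin (d + 1))) * ((((L ^ kk : ℕ) : ℝ))⁻¹)) * Real.exp (-(ρ * (unitTorusGeo L kk (cvM d L mv kk hL)).dist y y')) := by ring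

end Defect

end Summit.QuantumFields.YangMills.BalabanUVNodes.N15.Gluing

end
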